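import Mathlib
import Literature.NumberTheory.Sieve.SmoothCountLocal
import HarnessLib

/-!
# SmoothLocalBehaviourHT

Topic `Literature/NumberTheory/Sieve`. Named literature fact(s) relocated by the gate from `Summits/ABC/ABC/Theorems/CongruentialReceptacleTameLocalReceptacleStubSmoothLocalBehaviourOfHT.lean`
(accept-time relocation of `[cite]`d propositions written inline in a Summits proposal; human ruling 2026-08-15).
Sources: HildebrandTenenbaum1986.

* `Literature.NumberTheory.Sieve.HTLocalBehaviour`
-/

namespace Literature.NumberTheory.Sieve

open Finset Filter Topology
open Literature.NumberTheory.Sieve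

/-- **Hildebrand–Tenenbaum's local behaviour of `Ψ(x, y)`** (A. Hildebrand, G. Tenenbaum, *On integers free of large
prime factors*, Trans. Amer. Math. Soc. 296 (1986), 265–290, Theorem 3): uniformly for `x ≥ y ≥ 2` and `1 ≤ c ≤ y`,
`Ψ(cx, y) = Ψ(x, y) c^{α(x,y)} (1 + O(1/u + (log y)/y))`, `u = log x/log y`, `α(x, y)` the saddle point
(`Literature.NumberTheory.Sieve.saddlePoint`), `Ψ(z, y) = #{1 ≤ n ≤ z : p ∣ n ⇒ p ≤ y}` = `#(Nat.smoothNumbersUpTo ⌊z⌋₊ (y+1))`;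
one absolute implicit constant `C₀`. [cite: HildebrandTenenbaum1986, Thm 3] [file NumberTheory/Sieve/SmoothLocalBehaviourHT] -/
def HTLocalBehaviour : Prop :=
  ∃ C₀ : ℝ, ∀ (x : ℝ) (y : ℕ), 2 ≤ y → (y : ℝ) ≤ x → ∀ c : ℝ, 1 ≤ c → c ≤ (y : ℝ) →
    |((Nat.smoothNumbersUpTo ⌊c * x⌋₊ (y + 1)).card : ℝ) -
        c ^ saddlePoint x y * ((Nat.smoothNumbersUpTo ⌊x⌋₊ (y + 1)).card : ℝ)| ≤
      C₀ * (Real.log y / Real.log x + Real.log y / y) *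
        (c ^ saddlePoint x y * ((Nat.smoothNumbersUpTo ⌊x⌋₊ (y + 1)).card : ℝ))

/-! ### Two saddle-point inequalities -/

end Literature.NumberTheory.Sieve
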